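/-
Origin: expansion seat `planner-pub-hodgecm-pv05-g4-0`, handover #3 2026-08-18T08:01:06Z (`HOME/pub-hodgecm-pv05-g4/lean/Pv05g4/FockSeesawDualPair.lean`, md5 709768ac, 307 lines);
landed by the gen-7 packager in gate run 26 as `HodgeCM/PerL34/FockSeesawDualPair.lean` (import ^import Pv[0-9]+g[0-9]+\.→import HodgeCM.PerL34. ×1).
-/
/-
Origin: HOME/pub-hodgecm-pv05-g4/lean/Pv05g4/FockSeesawDualPair.lean — session planner-pub-hodgecm-pv05-g4-0 (unit pub-hodgecm-pv05-g4,
DAG-node prover #05 gen 4), node `FockSeesaw` part 3.  Intended final place: `HodgeCM/PerL34/FockSeesawDualPair.lean`.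
Imports this seat's `FockSeesawKTypes` (packager rewrite `^import Pv05g4\.FockSeesawKTypes$` ↦
`import HodgeCM.PerL34.FockSeesawKTypes`); asserts nothing, cites nothing.
-/
import Summits.HodgeConjecture.HodgeCM.PerL34.FockSeesawKTypes

set_option autoImplicit false

/-!
# Lemma 3.4 (seesaw) at `ι₁`, part 3: the small member `U(W) = U(2)` commutes with the diagonal `U(V)` —
# pv12's `U(2)_W` operators `EW j j'` commute with `ω_W(𝔤𝔩₃)`; its torus is `EW j j = weightOp (colWt j)`

The seesaw of PerL v5 Lemma 3.4 (`lem:seesaw`, used in Lemma 3.5 `lem:S12`) is the diagram of commuting pairs inside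
`Sp(𝕎)`, `𝕎 = V₃ ⊗ W`,
```
      U(W) = U(2)            U(V) × U(V)
          |          ✕            |
   T = U(W₁) × U(W₂)        U(V) (diagonal)
```
`FockSeesaw.lean` gave the right-hand column and the bottom row on the `K`-finite Fock model at `ι₁`
(`planeOsc = lineOsc 0 + lineOsc 1`, `lineOsc_zero_one_comm`, `T` factorwise), `FockSeesawKTypes.lean` the
`T`-isotypic decomposition.  This file supplies the left-hand column and the top pairing, KERNEL, hypothesis-free:

* `EW_self_eq_weightOp : EW j j = weightOp (colWt j)` — the torus `T` of pv12's `U(2)_W`-action (`ArchB.EW`) is the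
  pair of column-weight operators;
* **`EW_comm_planeOsc : EW j j' * planeOsc i k = planeOsc i k * EW j j'`** for all `j, j' ∈ Fin 2`, `i, k ∈ HarmVar`, and
  `EW_comm_planeOscRep` — `𝔲(W)_ℂ = 𝔤𝔩₂` (polynomial part) commutes with the diagonal `𝔲(V)_ℂ = 𝔤𝔩₃`:
  `(U(W), U(V))` act as a commuting pair on `ℂ[z_{aj}, w_j]`.

Method (no six-variable case bash): the off-diagonal `EW 0 1` is, through `pairMap`, the CANONICAL ELEMENT
`Σ_m c_m ⊗ a_m` (`canon`), where `c = (z₁·, z₂·, −∂_w)` (`cre`) transforms under `osc` as the standard representation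
`V` of `𝔤𝔩₃` (`osc_comm_cre : [ω(E_{ik}), c_m] = δ_{km} c_i`) and `a = (∂₁, ∂₂, w·)` (`ann`) as its dual
(`osc_comm_ann : [ω(E_{ik}), a_m] = −δ_{im} a_k`) — 54 one-line Weyl-algebra identities in `ℂ[z₁,z₂,w]`, by the same
`simp; ring` as pv05-g3's `osc_comm`; the canonical element of `V ⊗ V^*` is invariant (`tensorDer_osc_comp_canon`), and
`EW 1 0` is the transposed element `Σ_m a_m ⊗ c_m` (`canonT`).  The diagonal `EW j j` commute because they are scalar
on each `𝔤𝔩₃`-stable piece `F_k ⊗ F_l` (`FockSeesawKTypes.biPiece`).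

PRINT residual: none new (as in parts 1–2: group level / unitary completion / global = pv11 `Seesaw.lean` (b)).
PACKAGER: additive leaf; nothing imports it; ONE import rewrite; lands after `FockSeesawKTypes.lean`; axioms trio;
file-local `attribute [local instance 100] LieRing.ofAssociativeRing` not needed (no brackets used).
-/

namespace HodgeCM
namespace PerL34
namespace Fock

open MvPolynomial TensorProduct

/-! ## 1. Creation / annihilation vectors of the one-line model and their `𝔤𝔩₃`-covariance -/

section OneLine

variable {σ : Type*}

/-- Multiplication by the variable `X_v`. -/
noncomputable def mulX (v : σ) : Module.End ℂ (MvPolynomial σ ℂ) := LinearMap.mulLeft ℂ (X v)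

/-- (Ported verbatim from the HodgeCMPerL package; no docstring in the source.) -/
@[simp] theorem mulX_apply (v : σ) (f : MvPolynomial σ ℂ) : mulX v f = X v * f := rfl

/-- The partial derivative `∂_v` as a linear endomorphism. -/
noncomputable def derX (v : σ) : Module.End ℂ (MvPolynomial σ ℂ) where
  toFun f := pderiv v f
  map_add' f g := by simp only [map_add]
  map_smul' c f := by simp only [Derivation.map_smul, RingHom.id_apply]

/-- (Ported verbatim from the HodgeCMPerL package; no docstring in the source.) -/
@[simp] theorem derX_apply (v : σ) (f : MvPolynomial σ ℂ) : derX v f = pderiv v f := rfl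

/-- The CREATION-type vector `c = (z₁·, z₂·, −∂_w)`: it transforms under `osc` as the standard representation `V`. -/
noncomputable def cre : HarmVar → Module.End ℂ HarmModel
  | Sum.inl a => mulX (Sum.inl a)
  | Sum.inr _ => -derX (Sum.inr ())

/-- The ANNIHILATION-type vector `a = (∂₁, ∂₂, w·)`: it transforms under `osc` as the dual `V^*`. -/
noncomputable def ann : HarmVar → Module.End ℂ HarmModel
  | Sum.inl a => derX (Sum.inl a)
  | Sum.inr _ => mulX (Sum.inr ())

/-- (Ported verbatim from the HodgeCMPerL package; no docstring in the source.) -/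
@[simp] theorem cre_inl_apply (a : Fin 2) (f : HarmModel) : cre (Sum.inl a) f = X (Sum.inl a) * f := rfl
/-- (Ported verbatim from the HodgeCMPerL package; no docstring in the source.) -/
@[simp] theorem cre_inr_apply (u : Unit) (f : HarmModel) : cre (Sum.inr u) f = -pderiv (Sum.inr ()) f := rfl
/-- (Ported verbatim from the HodgeCMPerL package; no docstring in the source.) -/
@[simp] theorem ann_inl_apply (a : Fin 2) (f : HarmModel) : ann (Sum.inl a) f = pderiv (Sum.inl a) f := rfl
/-- (Ported verbatim from the HodgeCMPerL package; no docstring in the source.) -/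
@[simp] theorem ann_inr_apply (u : Unit) (f : HarmModel) : ann (Sum.inr u) f = X (Sum.inr ()) * f := rfl

/-- **`[ω(E_{ik}), c_m] = δ_{km} c_i`**: `c` spans a copy of the standard representation of `𝔤𝔩₃` in the Weyl algebra. -/
theorem osc_comm_cre (i k m : HarmVar) :
    osc i k * cre m - cre m * osc i k = if k = m then cre i else 0 := by
  apply LinearMap.ext
  intro f
  rcases i with i | ⟨⟩ <;> rcases k with k | ⟨⟩ <;> rcases m with m | ⟨⟩ <;>
    (try fin_cases i) <;> (try fin_cases k) <;> (try fin_cases m) <;>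
    simp [osc, hE_apply, hH_apply, hP_apply, hQ_apply, hz, hw] <;> ring

/-- **`[ω(E_{ik}), a_m] = −δ_{im} a_k`**: `a` spans a copy of the dual representation. -/
theorem osc_comm_ann (i k m : HarmVar) :
    osc i k * ann m - ann m * osc i k = if i = m then -ann k else 0 := by
  apply LinearMap.ext
  intro f
  rcases i with i | ⟨⟩ <;> rcases k with k | ⟨⟩ <;> rcases m with m | ⟨⟩ <;>
    (try fin_cases i) <;> (try fin_cases k) <;> (try fin_cases m) <;>
    simp [osc, hE_apply, hH_apply, hP_apply, hQ_apply, hz, hw] <;> ring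

/-- (Ported verbatim from the HodgeCMPerL package; no docstring in the source.) -/
theorem osc_cre_apply (i k m : HarmVar) (φ : HarmModel) :
    osc i k (cre m φ) = cre m (osc i k φ) + if k = m then cre i φ else 0 := by
  have h := LinearMap.congr_fun (osc_comm_cre i k m) φ
  simp only [LinearMap.sub_apply, Module.End.mul_apply] at h
  rw [sub_eq_iff_eq_add'.mp h]
  split_ifs <;> rfl

/-- (Ported verbatim from the HodgeCMPerL package; no docstring in the source.) -/
theorem osc_ann_apply (i k m : HarmVar) (φ : HarmModel) :
    osc i k (ann m φ) = ann m (osc i k φ) - if i = m then ann k φ else 0 := by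
  have h := LinearMap.congr_fun (osc_comm_ann i k m) φ
  simp only [LinearMap.sub_apply, Module.End.mul_apply] at h
  rw [sub_eq_iff_eq_add'.mp h]
  split_ifs <;> simp [sub_eq_add_neg]

end OneLine

/-! ## 2. The canonical elements `Σ_m c_m ⊗ a_m`, `Σ_m a_m ⊗ c_m` are `𝔤𝔩₃`-invariant -/

section Canonical

/-- `Σ_m c_m ⊗ a_m ∈ End(𝓕(V⊗W₁) ⊗ 𝓕(V⊗W₂))` — through `pairMap` this is pv12's `EW 0 1`. -/
noncomputable def canon : Module.End ℂ (HarmModel ⊗[ℂ] HarmModel) :=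
  ∑ m : HarmVar, TensorProduct.map (cre m) (ann m)

/-- `Σ_m a_m ⊗ c_m` — through `pairMap` this is `EW 1 0`. -/
noncomputable def canonT : Module.End ℂ (HarmModel ⊗[ℂ] HarmModel) :=
  ∑ m : HarmVar, TensorProduct.map (ann m) (cre m)

/-- (Ported verbatim from the HodgeCMPerL package; no docstring in the source.) -/
theorem canon_tmul (φ ψ : HarmModel) : canon (φ ⊗ₜ[ℂ] ψ) = ∑ m : HarmVar, cre m φ ⊗ₜ[ℂ] ann m ψ := by
  simp only [canon, LinearMap.sum_apply, TensorProduct.map_tmul]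

/-- (Ported verbatim from the HodgeCMPerL package; no docstring in the source.) -/
theorem canonT_tmul (φ ψ : HarmModel) : canonT (φ ⊗ₜ[ℂ] ψ) = ∑ m : HarmVar, ann m φ ⊗ₜ[ℂ] cre m ψ := by
  simp only [canonT, LinearMap.sum_apply, TensorProduct.map_tmul]

/-- **Invariance of the canonical element**: `[ω(X) ⊗ 1 + 1 ⊗ ω(X), Σ_m c_m ⊗ a_m] = 0` for `X = E_{ik}`. -/
theorem tensorDer_osc_comp_canon (i k : HarmVar) :
    tensorDer HarmModel (osc i k) ∘ₗ canon = canon ∘ₗ tensorDer HarmModel (osc i k) := by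
  refine TensorProduct.ext' fun φ ψ => ?_
  simp only [LinearMap.comp_apply, canon_tmul, map_sum, tensorDer_tmul, map_add, osc_cre_apply, osc_ann_apply,
    add_tmul, tmul_sub, ite_tmul, tmul_ite, Finset.sum_add_distrib, Finset.sum_sub_distrib,
    Finset.sum_ite_eq, Finset.mem_univ, if_true]
  abel

/-- The same for the transposed element. -/
theorem tensorDer_osc_comp_canonT (i k : HarmVar) :
    tensorDer HarmModel (osc i k) ∘ₗ canonT = canonT ∘ₗ tensorDer HarmModel (osc i k) := by
  refine TensorProduct.ext' fun φ ψ => ?_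
  simp only [LinearMap.comp_apply, canonT_tmul, map_sum, tensorDer_tmul, map_add, osc_cre_apply, osc_ann_apply,
    sub_tmul, tmul_add, ite_tmul, tmul_ite, Finset.sum_add_distrib, Finset.sum_sub_distrib,
    Finset.sum_ite_eq, Finset.mem_univ, if_true]
  abel

end Canonical

/-! ## 3. pv12's `EW j j'` through the tensor decomposition -/

section EWTensor

/-- (Ported verbatim from the HodgeCMPerL package; no docstring in the source.) -/
theorem pderiv_inl_one_pair (a : Fin 2) (φ ψ : HarmModel) :
    pderiv (Sum.inl (a, (1 : Fin 2))) (lineEmb 0 φ * lineEmb 1 ψ) = lineEmb 0 φ * lineEmb 1 (pderiv (Sum.inl a) ψ) := by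
  change pderiv (lineVar 1 (Sum.inl a)) _ = _
  rw [Derivation.leibniz, pderiv_lineVar_lineEmb_of_ne (show (1 : Fin 2) ≠ 0 by decide), pderiv_lineVar_lineEmb,
    smul_zero, add_zero, smul_eq_mul]

/-- (Ported verbatim from the HodgeCMPerL package; no docstring in the source.) -/
theorem pderiv_inl_zero_pair (a : Fin 2) (φ ψ : HarmModel) :
    pderiv (Sum.inl (a, (0 : Fin 2))) (lineEmb 0 φ * lineEmb 1 ψ) = lineEmb 0 (pderiv (Sum.inl a) φ) * lineEmb 1 ψ := by
  change pderiv (lineVar 0 (Sum.inl a)) _ = _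
  rw [Derivation.leibniz, pderiv_lineVar_lineEmb_of_ne (show (0 : Fin 2) ≠ 1 by decide), pderiv_lineVar_lineEmb,
    smul_zero, zero_add, smul_eq_mul, mul_comm]

/-- (Ported verbatim from the HodgeCMPerL package; no docstring in the source.) -/
theorem pderiv_inr_zero_pair (φ ψ : HarmModel) :
    pderiv (Sum.inr (0 : Fin 2)) (lineEmb 0 φ * lineEmb 1 ψ) = lineEmb 0 (pderiv (Sum.inr ()) φ) * lineEmb 1 ψ := by
  change pderiv (lineVar 0 (Sum.inr ())) _ = _
  rw [Derivation.leibniz, pderiv_lineVar_lineEmb_of_ne (show (0 : Fin 2) ≠ 1 by decide), pderiv_lineVar_lineEmb,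
    smul_zero, zero_add, smul_eq_mul, mul_comm]

/-- (Ported verbatim from the HodgeCMPerL package; no docstring in the source.) -/
theorem pderiv_inr_one_pair (φ ψ : HarmModel) :
    pderiv (Sum.inr (1 : Fin 2)) (lineEmb 0 φ * lineEmb 1 ψ) = lineEmb 0 φ * lineEmb 1 (pderiv (Sum.inr ()) ψ) := by
  change pderiv (lineVar 1 (Sum.inr ())) _ = _
  rw [Derivation.leibniz, pderiv_lineVar_lineEmb_of_ne (show (1 : Fin 2) ≠ 0 by decide), pderiv_lineVar_lineEmb,
    smul_zero, add_zero, smul_eq_mul]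

/-- **`EW 0 1 = Σ_m c_m ⊗ a_m`**: `E^W_{01}(φψ) = Σ_a (z_a φ)(∂_a ψ) − (∂_w φ)(w ψ)`. -/
theorem EW_zero_one_pairMap_tmul (φ ψ : HarmModel) :
    EW 0 1 (pairMap (φ ⊗ₜ[ℂ] ψ)) = pairMap (canon (φ ⊗ₜ[ℂ] ψ)) := by
  rw [canon_tmul, map_sum, Fintype.sum_sum_type, Fin.sum_univ_two, Fintype.sum_unique, pairMap_tmul, pairMap_tmul,
    pairMap_tmul, pairMap_tmul, EW_apply, pderiv_inl_one_pair, pderiv_inl_one_pair, pderiv_inr_zero_pair]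
  simp only [cre_inl_apply, cre_inr_apply, ann_inl_apply, ann_inr_apply, map_mul, map_neg, lineEmb_X, lineVar_inl,
    lineVar_inr, z, w]
  ring

/-- **`EW 1 0 = Σ_m a_m ⊗ c_m`.** -/
theorem EW_one_zero_pairMap_tmul (φ ψ : HarmModel) :
    EW 1 0 (pairMap (φ ⊗ₜ[ℂ] ψ)) = pairMap (canonT (φ ⊗ₜ[ℂ] ψ)) := by
  rw [canonT_tmul, map_sum, Fintype.sum_sum_type, Fin.sum_univ_two, Fintype.sum_unique, pairMap_tmul, pairMap_tmul,
    pairMap_tmul, pairMap_tmul, EW_apply, pderiv_inl_zero_pair, pderiv_inl_zero_pair, pderiv_inr_one_pair]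
  simp only [cre_inl_apply, cre_inr_apply, ann_inl_apply, ann_inr_apply, map_mul, map_neg, lineEmb_X, lineVar_inl,
    lineVar_inr, z, w]
  ring

/-- (Ported verbatim from the HodgeCMPerL package; no docstring in the source.) -/
theorem EW_zero_one_comp_pairMap :
    EW 0 1 ∘ₗ (pairMap : HarmModel ⊗[ℂ] HarmModel →ₐ[ℂ] PlaneModel).toLinearMap =
      (pairMap : HarmModel ⊗[ℂ] HarmModel →ₐ[ℂ] PlaneModel).toLinearMap ∘ₗ canon :=
  TensorProduct.ext' fun φ ψ => by
    simp only [LinearMap.comp_apply, AlgHom.toLinearMap_apply, EW_zero_one_pairMap_tmul]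

/-- (Ported verbatim from the HodgeCMPerL package; no docstring in the source.) -/
theorem EW_one_zero_comp_pairMap :
    EW 1 0 ∘ₗ (pairMap : HarmModel ⊗[ℂ] HarmModel →ₐ[ℂ] PlaneModel).toLinearMap =
      (pairMap : HarmModel ⊗[ℂ] HarmModel →ₐ[ℂ] PlaneModel).toLinearMap ∘ₗ canonT :=
  TensorProduct.ext' fun φ ψ => by
    simp only [LinearMap.comp_apply, AlgHom.toLinearMap_apply, EW_one_zero_pairMap_tmul]

/-- **The torus of `U(2)_W` is `T`**: `E^W_{jj} = Σ_a z_{aj}∂_{z_{aj}} − w_j∂_{w_j}` is the column-`j` weight operator. -/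
theorem EW_self_eq_weightOp (j : Fin 2) : EW j j = weightOp (colWt j) := by
  apply LinearMap.ext
  intro f
  rw [EW_apply, weightOp_apply, Fintype.sum_sum_type, Fintype.sum_prod_type, Fin.sum_univ_two, Fin.sum_univ_two,
    Fin.sum_univ_two, Fin.sum_univ_two]
  fin_cases j <;> simp [colWt, z, w] <;> ring

end EWTensor

/-! ## 4. `U(W)` commutes with the diagonal `U(V)` -/

section Commute

/-- Transport of a commutation relation through the surjection `pairMap`. -/
theorem comm_of_comp_pairMap {P Q : Module.End ℂ PlaneModel} {p q : Module.End ℂ (HarmModel ⊗[ℂ] HarmModel)}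
    (hP : P ∘ₗ (pairMap : HarmModel ⊗[ℂ] HarmModel →ₐ[ℂ] PlaneModel).toLinearMap =
      (pairMap : HarmModel ⊗[ℂ] HarmModel →ₐ[ℂ] PlaneModel).toLinearMap ∘ₗ p)
    (hQ : Q ∘ₗ (pairMap : HarmModel ⊗[ℂ] HarmModel →ₐ[ℂ] PlaneModel).toLinearMap =
      (pairMap : HarmModel ⊗[ℂ] HarmModel →ₐ[ℂ] PlaneModel).toLinearMap ∘ₗ q)
    (hpq : p ∘ₗ q = q ∘ₗ p) : P * Q = Q * P := by
  apply LinearMap.ext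
  intro f
  obtain ⟨x, rfl⟩ : ∃ x, pairMap x = f := ⟨_, pairMap_pairLinearEquiv_symm f⟩
  have hP' := fun y => LinearMap.congr_fun hP y
  have hQ' := fun y => LinearMap.congr_fun hQ y
  have hpq' := LinearMap.congr_fun hpq x
  simp only [LinearMap.comp_apply, AlgHom.toLinearMap_apply] at hP' hQ' hpq'
  simp only [Module.End.mul_apply, hP', hQ', hpq']

/-- `E^W_{01}` commutes with every `ω_W(E_{ik})`. -/
theorem EW_zero_one_comm_planeOsc (i k : HarmVar) : EW 0 1 * planeOsc i k = planeOsc i k * EW 0 1 :=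
  comm_of_comp_pairMap EW_zero_one_comp_pairMap (planeOsc_comp_pairMap i k)
    (tensorDer_osc_comp_canon i k).symm

/-- `E^W_{10}` commutes with every `ω_W(E_{ik})`. -/
theorem EW_one_zero_comm_planeOsc (i k : HarmVar) : EW 1 0 * planeOsc i k = planeOsc i k * EW 1 0 :=
  comm_of_comp_pairMap EW_one_zero_comp_pairMap (planeOsc_comp_pairMap i k)
    (tensorDer_osc_comp_canonT i k).symm

/-- The column-weight operators commute with every `ω_W(E_{ik})` (they are scalar on each `𝔤𝔩₃`-stable
`F_k ⊗ F_l`, and these span). -/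
theorem weightOp_colWt_comm_planeOsc (j : Fin 2) (i k : HarmVar) :
    (weightOp (colWt j) : Module.End ℂ PlaneModel) * planeOsc i k = planeOsc i k * weightOp (colWt j) := by
  apply LinearMap.ext
  intro f
  have hf : f ∈ ⨆ kl : ℤ × ℤ, biPiece kl.1 kl.2 := by rw [iSup_biPiece_eq_top]; exact Submodule.mem_top
  refine Submodule.iSup_induction _
    (motive := fun g => ((weightOp (colWt j) : Module.End ℂ PlaneModel) * planeOsc i k) g =
      (planeOsc i k * weightOp (colWt j)) g) hf (fun kl g hg => ?_) (by simp only [map_zero])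
    (fun g g' hg hg' => by rw [map_add, map_add, hg, hg'])
  have hg' := planeOsc_mem_biPiece kl.1 kl.2 i k g hg
  have hj : j = 0 ∨ j = 1 := by fin_cases j <;> simp
  rcases hj with rfl | rfl
  · rw [Module.End.mul_apply, Module.End.mul_apply, weightOp_colWt_zero_of_mem_biPiece hg',
      weightOp_colWt_zero_of_mem_biPiece hg, map_smul]
  · rw [Module.End.mul_apply, Module.End.mul_apply, weightOp_colWt_one_of_mem_biPiece hg',
      weightOp_colWt_one_of_mem_biPiece hg, map_smul]

/-- **`(U(W), U(V))` commute on the plane Fock model** (Lie-algebra level, polynomial part): every `E^W_{jj'}` of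
pv12's `U(2)_W`-action commutes with every `ω_W(E_{ik})` of the diagonal oscillator action of `𝔤𝔩₃ = 𝔲(V)_ℂ`. -/
theorem EW_comm_planeOsc (j j' : Fin 2) (i k : HarmVar) : EW j j' * planeOsc i k = planeOsc i k * EW j j' := by
  have hj : j = 0 ∨ j = 1 := by fin_cases j <;> simp
  have hj' : j' = 0 ∨ j' = 1 := by fin_cases j' <;> simp
  rcases hj with rfl | rfl <;> rcases hj' with rfl | rfl
  · rw [EW_self_eq_weightOp]; exact weightOp_colWt_comm_planeOsc 0 i k
  · exact EW_zero_one_comm_planeOsc i k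
  · exact EW_one_zero_comm_planeOsc i k
  · rw [EW_self_eq_weightOp]; exact weightOp_colWt_comm_planeOsc 1 i k

/-- The same for `ω_W(A)`, `A ∈ 𝔤𝔩₃(ℂ)` arbitrary. -/
theorem EW_comm_planeOscRep (j j' : Fin 2) (A : Matrix HarmVar HarmVar ℂ) :
    EW j j' * planeOscRep A = planeOscRep A * EW j j' := by
  rw [planeOscRep_apply, Finset.mul_sum, Finset.sum_mul]
  refine Finset.sum_congr rfl fun i _ => ?_
  rw [Finset.mul_sum, Finset.sum_mul]
  refine Finset.sum_congr rfl fun k _ => ?_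
  rw [mul_smul_comm, smul_mul_assoc, EW_comm_planeOsc]

/-- `U(W)` moves the `T`-isotypic pieces: `E^W_{01}` and `E^W_{10}` preserve `𝔤𝔩₃`-stability, e.g. the image of a
`𝔤𝔩₃`-stable subspace under `E^W_{jj'}` is `𝔤𝔩₃`-stable. -/
theorem planeOsc_map_EW_mem {M : Submodule ℂ PlaneModel} (hM : ∀ i k, ∀ f ∈ M, planeOsc i k f ∈ M) (j j' : Fin 2)
    (i k : HarmVar) : ∀ f ∈ M.map (EW j j'), planeOsc i k f ∈ M.map (EW j j') := by
  rintro f ⟨g, hg, rfl⟩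
  refine ⟨planeOsc i k g, hM i k g hg, ?_⟩
  have h := LinearMap.congr_fun (EW_comm_planeOsc j j' i k) g
  simpa only [Module.End.mul_apply] using h

end Commute

end Fock
end PerL34
end HodgeCM
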